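import Mathlib
import Summits.KontsevichZagierPeriods.KontsevichZagierPeriods.Theorems.IsogenyCertificatesJLPairAlgebra
import Summits.KontsevichZagierPeriods.KontsevichZagierPeriods.Theorems.IsogenyCertificatesJLPairSignsA
import Summits.KontsevichZagierPeriods.KontsevichZagierPeriods.Theorems.IsogenyCertificatesJLPairSignsB
import HarnessLib

/-!
# The Jacquet–Langlands correspondence for `X_0^{35}`: the real branches, pointwise

Support file for `JLPairIdentityX` (stmt-KontsevichZagierPeriods-14655). Over `u < −1` the
correspondence `Z : Q(u) x² − P₁(u) x + P₂(u) = 0` has two real branches, `x_b = (P₁ + √disc)/(2Q)`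
with values in the big oval `(−1/4, 0)` of `X(ℝ)` and `x_t = (P₁ − √disc)/(2Q)` with values in the
tiny oval `(−4/9, ρ)`; this reality is forced by the auxiliary divisor `(0,0) + (−4/9,0)` (one
Weierstrass point on each oval). DEFINES the branch data `fX fC sD xb xt dxb dxt Mb Mt gb gt` and
proves the pointwise facts (roots/Vieta, `−1/4 < x_b < 0`, `−4/9 < x_t < −11/25`, `M_b, M_t, x_b' > 0`,
`sign x_t' = −sign R_c`, on-curve at both branches, `√f_X(x_b) = M_b √f_C / E`, `g_b + g_t = (4+2u)/√f_C`).
-/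

namespace Summit.KontsevichZagierPeriods.IsogenyCertificates.JLPair

open Literature.Algebra.Polynomial

/-! ### The real branches of the correspondence over `u < −1` -/

/-- `f_X(x) = −x(9x+4)(4x+1)(172x³+176x²+60x+7)`, the sextic of `X = X_0^{35}/⟨ω_5⟩` (Molina).
[cite: Molina2012, Table 2] -/
def fX (x : ℝ) : ℝ := -x * (9 * x + 4) * (4 * x + 1) * (172 * x ^ 3 + 176 * x ^ 2 + 60 * x + 7)

/-- `f_C(u) = (u²+4)(u+1)(u³−5u²+3u−19)`, the sextic of `C = X_0(35)/⟨w_7⟩`.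
[evidence: stmt-KontsevichZagierPeriods-14646] -/
def fC (u : ℝ) : ℝ := (u ^ 2 + 4) * (u + 1) * (u ^ 3 - 5 * u ^ 2 + 3 * u - 19)

/-- `s(u) = √disc(u)`, `disc = P₁² − 4QP₂` (positive on `(−∞,−1]`). [folklore] -/
noncomputable def sD (u : ℝ) : ℝ := Real.sqrt (CoeffList.eval u cD)

/-- The big-oval branch `x_b(u) = (P₁ + √disc)/(2Q)` of `Q x² − P₁ x + P₂ = 0` (values in `(−1/4, 0)`
for `u < −1`). [evidence: stmt-KontsevichZagierPeriods-14655 REPORT.md §4] -/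
noncomputable def xb (u : ℝ) : ℝ := (CoeffList.eval u cP1 + sD u) / (2 * CoeffList.eval u cQ)

/-- The tiny-oval branch `x_t(u) = (P₁ − √disc)/(2Q)` (values in `(−4/9, −0.44)` for `u < −1`).
[evidence: stmt-KontsevichZagierPeriods-14655 REPORT.md §4] -/
noncomputable def xt (u : ℝ) : ℝ := (CoeffList.eval u cP1 - sD u) / (2 * CoeffList.eval u cQ)

/-- The derivative of `x_b`: `x_b' = (x_b D₁ − D₂)/(Q √disc)` (implicit differentiation). [folklore] -/
noncomputable def dxb (u : ℝ) : ℝ := (xb u * CoeffList.eval u cD1 - CoeffList.eval u cD2) / (CoeffList.eval u cQ * sD u)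

/-- The derivative of `x_t`: `x_t' = (x_t D₁ − D₂)/(−Q √disc)`. [folklore] -/
noncomputable def dxt (u : ℝ) : ℝ := (xt u * CoeffList.eval u cD1 - CoeffList.eval u cD2) / (-(CoeffList.eval u cQ * sD u))

/-- `M_b = N₁ x_b + N₀` (so that `y_b = M_b w / E` on the correspondence). [folklore] -/
noncomputable def Mb (u : ℝ) : ℝ := CoeffList.eval u cN1 * xb u + CoeffList.eval u cN0

/-- `M_t = N₁ x_t + N₀`. [folklore] -/
noncomputable def Mt (u : ℝ) : ℝ := CoeffList.eval u cN1 * xt u + CoeffList.eval u cN0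

/-- The big-branch integrand on `u < −1`: `g_b = x_b x_b' E/(M_b √f_C) = x_b x_b'/√f_X(x_b)`,
the pull-back of `x dx/√f_X` along `x_b`. [evidence: stmt-KontsevichZagierPeriods-14655 REPORT.md §4] -/
noncomputable def gb (u : ℝ) : ℝ := xb u * dxb u * CoeffList.eval u cE / (Mb u * Real.sqrt (fC u))

/-- The tiny-branch integrand on `u < −1`: `g_t = x_t x_t' E/(M_t √f_C)` (signed: `x_t'` changes sign
at the turning point `u_m`). [evidence: stmt-KontsevichZagierPeriods-14655 REPORT.md §4] -/
noncomputable def gt (u : ℝ) : ℝ := xt u * dxt u * CoeffList.eval u cE / (Mt u * Real.sqrt (fC u))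

/-! ### Pointwise algebra of the branches on `u < −1` -/

section Pointwise

/-- `√disc > 0` on `(−∞,−1]`. [folklore] -/
theorem sD_pos {u : ℝ} (hu : u ≤ -1) : 0 < sD u := Real.sqrt_pos.mpr (D_pos hu)

/-- `(√disc)² = P₁² − 4QP₂` on `(−∞,−1]`. [folklore] -/
theorem sD_sq {u : ℝ} (hu : u ≤ -1) :
    sD u ^ 2 = CoeffList.eval u cP1 ^ 2 - 4 * CoeffList.eval u cQ * CoeffList.eval u cP2 := by
  rw [sD, Real.sq_sqrt (D_pos hu).le, eval_cD]

/-- `x_b` is a root: `Q x_b² − P₁ x_b + P₂ = 0`. [folklore] -/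
theorem xb_root {u : ℝ} (hu : u ≤ -1) :
    CoeffList.eval u cQ * xb u ^ 2 - CoeffList.eval u cP1 * xb u + CoeffList.eval u cP2 = 0 := by
  have hQ := (Q_pos hu).ne'
  have hs := sD_sq hu
  unfold xb
  field_simp
  linear_combination hs

/-- `x_t` is a root: `Q x_t² − P₁ x_t + P₂ = 0`. [folklore] -/
theorem xt_root {u : ℝ} (hu : u ≤ -1) :
    CoeffList.eval u cQ * xt u ^ 2 - CoeffList.eval u cP1 * xt u + CoeffList.eval u cP2 = 0 := by
  have hQ := (Q_pos hu).ne'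
  have hs := sD_sq hu
  unfold xt
  field_simp
  linear_combination hs

/-- `x_b − x_t = √disc/Q > 0`. [folklore] -/
theorem xb_sub_xt {u : ℝ} (hu : u ≤ -1) : xb u - xt u = sD u / CoeffList.eval u cQ := by
  have hQ := (Q_pos hu).ne'
  unfold xb xt
  field_simp
  ring

/-- `x_t < x_b`. [folklore] -/
theorem xt_lt_xb {u : ℝ} (hu : u ≤ -1) : xt u < xb u := by
  have h := xb_sub_xt hu
  have : 0 < sD u / CoeffList.eval u cQ := div_pos (sD_pos hu) (Q_pos hu)
  linarith

/-- Vieta: `x_b + x_t = P₁/Q`. [folklore] -/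
theorem xb_add_xt {u : ℝ} (hu : u ≤ -1) : xb u + xt u = CoeffList.eval u cP1 / CoeffList.eval u cQ := by
  have hQ := (Q_pos hu).ne'
  unfold xb xt
  field_simp
  ring

/-- Vieta: `x_b x_t = P₂/Q`. [folklore] -/
theorem xb_mul_xt {u : ℝ} (hu : u ≤ -1) : xb u * xt u = CoeffList.eval u cP2 / CoeffList.eval u cQ := by
  have hQ := (Q_pos hu).ne'
  have hs := sD_sq hu
  unfold xb xt
  field_simp
  linear_combination -hs

/-- The shifted products: `(x_b + c)(x_t + c) = (P₂ + c P₁ + c² Q)/Q`. [folklore] -/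
theorem shift_mul {u : ℝ} (hu : u ≤ -1) (c : ℝ) :
    (xb u + c) * (xt u + c) =
      (CoeffList.eval u cP2 + c * CoeffList.eval u cP1 + c ^ 2 * CoeffList.eval u cQ) / CoeffList.eval u cQ := by
  have hQ := (Q_pos hu).ne'
  have e1 := xb_add_xt hu
  have e2 := xb_mul_xt hu
  have : (xb u + c) * (xt u + c) = xb u * xt u + c * (xb u + xt u) + c ^ 2 := by ring
  rw [this, e1, e2]
  field_simp

/-- `(x_b + 1/4)(x_t + 1/4) < 0` for `u < −1`. [folklore] -/
theorem shift14_neg {u : ℝ} (hu : u < -1) : (xb u + 1 / 4) * (xt u + 1 / 4) < 0 := by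
  rw [shift_mul hu.le]
  apply div_neg_of_neg_of_pos _ (Q_pos hu.le)
  have h := B14_neg hu
  simp only [cB14, CoeffList.eval_add, CoeffList.eval_smul] at h
  push_cast at h
  linarith

/-- `(x_b + 4/9)(x_t + 4/9) > 0` for `u < −1`. [folklore] -/
theorem shift49_pos {u : ℝ} (hu : u < -1) : 0 < (xb u + 4 / 9) * (xt u + 4 / 9) := by
  rw [shift_mul hu.le]
  apply div_pos _ (Q_pos hu.le)
  have h := B49_pos hu
  simp only [cB49, CoeffList.eval_add, CoeffList.eval_smul] at h
  push_cast at h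
  linarith

/-- `(x_b + 11/25)(x_t + 11/25) < 0` for `u ≤ −1`. [folklore] -/
theorem shift1125_neg {u : ℝ} (hu : u ≤ -1) : (xb u + 11 / 25) * (xt u + 11 / 25) < 0 := by
  rw [shift_mul hu]
  apply div_neg_of_neg_of_pos _ (Q_pos hu)
  have h := B1125_neg hu
  simp only [cB1125, CoeffList.eval_add, CoeffList.eval_smul] at h
  push_cast at h
  linarith

/-- `x_t < −11/25` on `(−∞,−1]` (in particular `x_t + 1/4 < −19/100 < 0`). [folklore] -/
theorem xt_lt {u : ℝ} (hu : u ≤ -1) : xt u < -11 / 25 := by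
  have h := shift1125_neg hu
  have hlt := xt_lt_xb hu
  by_contra hge
  rw [not_lt] at hge
  have h1 : 0 ≤ xt u + 11 / 25 := by linarith
  have h2 : 0 ≤ xb u + 11 / 25 := by linarith
  exact absurd h (not_lt.mpr (mul_nonneg h2 h1))

/-- `−1/4 < x_b` for `u < −1`. [folklore] -/
theorem xb_gt {u : ℝ} (hu : u < -1) : -1 / 4 < xb u := by
  have h := shift14_neg hu
  have ht : xt u + 1 / 4 < 0 := by linarith [xt_lt hu.le]
  by_contra hle
  rw [not_lt] at hle
  have : 0 ≤ (xb u + 1 / 4) * (xt u + 1 / 4) := mul_nonneg_of_nonpos_of_nonpos (by linarith) ht.le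
  exact absurd h (not_lt.mpr this)

/-- `x_b < 0` for `u < −1`. [folklore] -/
theorem xb_lt {u : ℝ} (hu : u < -1) : xb u < 0 := by
  have hprod : 0 < xb u * xt u := by
    rw [xb_mul_xt hu.le]; exact div_pos (P2_pos hu) (Q_pos hu.le)
  have ht : xt u < 0 := by linarith [xt_lt hu.le]
  by_contra hge
  rw [not_lt] at hge
  exact absurd hprod (not_lt.mpr (mul_nonpos_of_nonneg_of_nonpos hge ht.le))

/-- `−4/9 < x_t` for `u < −1`. [folklore] -/
theorem xt_gt {u : ℝ} (hu : u < -1) : -4 / 9 < xt u := by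
  have h := shift49_pos hu
  have hb : 0 < xb u + 4 / 9 := by linarith [xb_gt hu]
  by_contra hle
  rw [not_lt] at hle
  have : (xb u + 4 / 9) * (xt u + 4 / 9) ≤ 0 := mul_nonpos_of_nonneg_of_nonpos hb.le (by linarith)
  exact absurd h (not_lt.mpr this)

/-- `E > 0` on `(−∞,−1]`. [folklore] -/
theorem E_pos {u : ℝ} (hu : u ≤ -1) : 0 < CoeffList.eval u cE := by
  rw [eval_cE]; have := Q_pos hu; positivity

/-- `M_b > 0` and `M_t > 0` on `(−∞,−1]` (the product `4Q² M_b M_t = Rₙ > 0` and the sum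
`Q(M_b + M_t) = Sₙ > 0`). [folklore] -/
theorem Mb_pos_and_Mt_pos {u : ℝ} (hu : u ≤ -1) : 0 < Mb u ∧ 0 < Mt u := by
  have hQ := Q_pos hu
  have hs := sD_sq hu
  have hprod : Mb u * Mt u = CoeffList.eval u cRn / (4 * CoeffList.eval u cQ ^ 2) := by
    have h1 : CoeffList.eval u cRn = CoeffList.eval u cSn ^ 2 - CoeffList.eval u cN1 ^ 2 * CoeffList.eval u cD := by
      simp [cRn]; ring
    have h2 : CoeffList.eval u cSn = CoeffList.eval u cN1 * CoeffList.eval u cP1 +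
        2 * CoeffList.eval u cQ * CoeffList.eval u cN0 := by
      simp [cSn]; ring
    rw [h1, h2, eval_cD]
    unfold Mb Mt xb xt
    field_simp
    linear_combination (-4 * CoeffList.eval u cN1 ^ 2) * hs
  have hsum : Mb u + Mt u = CoeffList.eval u cSn / CoeffList.eval u cQ := by
    have h2 : CoeffList.eval u cSn = CoeffList.eval u cN1 * CoeffList.eval u cP1 +
        2 * CoeffList.eval u cQ * CoeffList.eval u cN0 := by
      simp [cSn]; ring
    rw [h2]
    unfold Mb Mt
    rw [show CoeffList.eval u cN1 * xb u + CoeffList.eval u cN0 + (CoeffList.eval u cN1 * xt u + CoeffList.eval u cN0)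
        = CoeffList.eval u cN1 * (xb u + xt u) + 2 * CoeffList.eval u cN0 by ring, xb_add_xt hu]
    field_simp
  have hp : 0 < Mb u * Mt u := by rw [hprod]; exact div_pos (Rn_pos hu) (by positivity)
  have hsu : 0 < Mb u + Mt u := by rw [hsum]; exact div_pos (Sn_pos hu) hQ
  rcases pos_and_pos_or_neg_and_neg_of_mul_pos hp with h | h
  · exact h
  · exfalso; linarith [h.1, h.2]

/-- `x_b' > 0` on `(−∞,−1]`: `W₊ = 2Q(x_b D₁ − D₂)` satisfies `W₊ − W₋ = 2√disc D₁ > 0` and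
`W₊ + W₋ = 2 S_c > 0`. [folklore] -/
theorem dxb_pos {u : ℝ} (hu : u ≤ -1) : 0 < dxb u := by
  have hQ := Q_pos hu
  have hs0 := sD_pos hu
  have hD1 := D1_pos hu
  have hSc := Sc_pos hu
  have h2 : CoeffList.eval u cSc = CoeffList.eval u cP1 * CoeffList.eval u cD1 -
      2 * CoeffList.eval u cQ * CoeffList.eval u cD2 := by
    simp [cSc]; ring
  -- numerator: x_b D1 - D2 = ((P1 + s) D1 - 2 Q D2)/(2Q) = (Sc + s D1)/(2Q) > 0
  have hnum : xb u * CoeffList.eval u cD1 - CoeffList.eval u cD2 =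
      (CoeffList.eval u cSc + sD u * CoeffList.eval u cD1) / (2 * CoeffList.eval u cQ) := by
    rw [h2]; unfold xb; field_simp; ring
  unfold dxb
  rw [hnum]
  positivity

/-- The sign of `x_t'` is opposite to the sign of `R_c`: `x_t' · (positive) = −R_c · (positive)`;
precisely `x_t' = −W₋/(2Q²√disc)` with `W₊ W₋ = R_c` and `W₊ > 0`. We record:
`x_t' > 0` where `R_c < 0`, `x_t' < 0` where `R_c > 0`, and `x_t' ≠ 0` where `R_c ≠ 0`. [folklore] -/
theorem dxt_mul_eq {u : ℝ} (hu : u ≤ -1) :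
    dxt u * (2 * CoeffList.eval u cQ ^ 2 * sD u * (CoeffList.eval u cSc + sD u * CoeffList.eval u cD1)) =
      -CoeffList.eval u cRc := by
  have hQ := (Q_pos hu).ne'
  have hs0 := (sD_pos hu).ne'
  have hs := sD_sq hu
  have h1 : CoeffList.eval u cRc = CoeffList.eval u cSc ^ 2 - CoeffList.eval u cD * CoeffList.eval u cD1 ^ 2 := by
    simp [cRc]; ring
  have h2 : CoeffList.eval u cSc = CoeffList.eval u cP1 * CoeffList.eval u cD1 -
      2 * CoeffList.eval u cQ * CoeffList.eval u cD2 := by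
    simp [cSc]; ring
  rw [h1, h2, eval_cD]
  unfold dxt xt
  field_simp
  linear_combination (CoeffList.eval u cD1 ^ 2) * hs

/-- `x_t' > 0` where `R_c < 0` (on `(−∞,−1]`). [folklore] -/
theorem dxt_pos_of_Rc_neg {u : ℝ} (hu : u ≤ -1) (h : CoeffList.eval u cRc < 0) : 0 < dxt u := by
  have key := dxt_mul_eq hu
  have hpos : 0 < 2 * CoeffList.eval u cQ ^ 2 * sD u * (CoeffList.eval u cSc + sD u * CoeffList.eval u cD1) := by
    have := Q_pos hu; have := sD_pos hu; have := Sc_pos hu; have := D1_pos hu; positivity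
  by_contra hle; rw [not_lt] at hle
  have : dxt u * _ ≤ 0 := mul_nonpos_of_nonpos_of_nonneg hle hpos.le
  linarith

/-- `x_t' < 0` where `R_c > 0` (on `(−∞,−1]`). [folklore] -/
theorem dxt_neg_of_Rc_pos {u : ℝ} (hu : u ≤ -1) (h : 0 < CoeffList.eval u cRc) : dxt u < 0 := by
  have key := dxt_mul_eq hu
  have hpos : 0 < 2 * CoeffList.eval u cQ ^ 2 * sD u * (CoeffList.eval u cSc + sD u * CoeffList.eval u cD1) := by
    have := Q_pos hu; have := sD_pos hu; have := Sc_pos hu; have := D1_pos hu; positivity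
  by_contra hge; rw [not_lt] at hge
  have : 0 ≤ dxt u * _ := mul_nonneg hge hpos.le
  linarith

/-- `f_C > 0` on `(−∞, −1)`. [folklore] -/
theorem fC_pos {u : ℝ} (hu : u < -1) : 0 < fC u := by
  unfold fC
  have h1 : 0 < u ^ 2 + 4 := by positivity
  have h2 : u + 1 < 0 := by linarith
  have h3 : u ^ 3 - 5 * u ^ 2 + 3 * u - 19 < 0 := by nlinarith [sq_nonneg u]
  have := mul_pos_of_neg_of_neg (mul_neg_of_pos_of_neg h1 h2) h3
  simpa [mul_assoc] using this

/-- On the correspondence both branch points lie on `X`: `E² f_X(x_b) = M_b² f_C` and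
`E² f_X(x_t) = M_t² f_C`. [evidence: stmt-KontsevichZagierPeriods-14655 REPORT.md §3 (i)] -/
theorem onCurve_b {u : ℝ} (hu : u ≤ -1) : CoeffList.eval u cE ^ 2 * fX (xb u) = Mb u ^ 2 * fC u := by
  have h := onCurve u (xb u) (Q_pos hu).ne' (xb_root hu)
  unfold fX Mb fC
  linear_combination h

/-- See `onCurve_b`. [evidence: stmt-KontsevichZagierPeriods-14655 REPORT.md §3 (i)] -/
theorem onCurve_t {u : ℝ} (hu : u ≤ -1) : CoeffList.eval u cE ^ 2 * fX (xt u) = Mt u ^ 2 * fC u := by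
  have h := onCurve u (xt u) (Q_pos hu).ne' (xt_root hu)
  unfold fX Mt fC
  linear_combination h

/-- `f_X(x_b(u)) > 0` for `u < −1` (the branch lies over the real locus of `X`). [folklore] -/
theorem fX_xb_pos {u : ℝ} (hu : u < -1) : 0 < fX (xb u) := by
  have h := onCurve_b hu.le
  have hE := E_pos hu.le
  have hM := (Mb_pos_and_Mt_pos hu.le).1
  have hf := fC_pos hu
  have : 0 < CoeffList.eval u cE ^ 2 * fX (xb u) := by rw [h]; positivity
  exact pos_of_mul_pos_right this (by positivity)

/-- `f_X(x_t(u)) > 0` for `u < −1`. [folklore] -/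
theorem fX_xt_pos {u : ℝ} (hu : u < -1) : 0 < fX (xt u) := by
  have h := onCurve_t hu.le
  have hE := E_pos hu.le
  have hM := (Mb_pos_and_Mt_pos hu.le).2
  have hf := fC_pos hu
  have : 0 < CoeffList.eval u cE ^ 2 * fX (xt u) := by rw [h]; positivity
  exact pos_of_mul_pos_right this (by positivity)

/-- `√f_X(x_b) = M_b √f_C / E` for `u < −1`. [folklore] -/
theorem sqrt_fX_xb {u : ℝ} (hu : u < -1) :
    Real.sqrt (fX (xb u)) = Mb u * Real.sqrt (fC u) / CoeffList.eval u cE := by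
  have hE := E_pos hu.le
  have hM := (Mb_pos_and_Mt_pos hu.le).1
  have hf := fC_pos hu
  rw [eq_div_iff hE.ne']
  have h := onCurve_b hu.le
  have : fX (xb u) = (Mb u * Real.sqrt (fC u) / CoeffList.eval u cE) ^ 2 := by
    rw [div_pow, mul_pow, Real.sq_sqrt hf.le]
    field_simp
    linear_combination h
  rw [this, Real.sqrt_sq (by positivity)]
  field_simp

/-- `√f_X(x_t) = M_t √f_C / E` for `u < −1`. [folklore] -/
theorem sqrt_fX_xt {u : ℝ} (hu : u < -1) :
    Real.sqrt (fX (xt u)) = Mt u * Real.sqrt (fC u) / CoeffList.eval u cE := by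
  have hE := E_pos hu.le
  have hM := (Mb_pos_and_Mt_pos hu.le).2
  have hf := fC_pos hu
  rw [eq_div_iff hE.ne']
  have h := onCurve_t hu.le
  have : fX (xt u) = (Mt u * Real.sqrt (fC u) / CoeffList.eval u cE) ^ 2 := by
    rw [div_pow, mul_pow, Real.sq_sqrt hf.le]
    field_simp
    linear_combination h
  rw [this, Real.sqrt_sq (by positivity)]
  field_simp

/-- **The integrand identity of the rule-(1b) step**: on `u < −1`,
`g_b + g_t = (4 + 2u)/√f_C(u)` (from `trace_row2` with `s = √disc`).
[evidence: stmt-KontsevichZagierPeriods-14655 REPORT.md §4] -/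
theorem gb_add_gt {u : ℝ} (hu : u < -1) : gb u + gt u = (4 + 2 * u) / Real.sqrt (fC u) := by
  have hQ := (Q_pos hu.le).ne'
  have hs0 := (sD_pos hu.le).ne'
  have hs := sD_sq hu.le
  have hM := Mb_pos_and_Mt_pos hu.le
  have hf : 0 < Real.sqrt (fC u) := Real.sqrt_pos.mpr (fC_pos hu)
  have key := trace_row2 u (sD u) hs hs0 hQ (by simpa [Mb, xb] using hM.1.ne') (by simpa [Mt, xt] using hM.2.ne')
  -- `key` is literally `xb·dxb·E/Mb + xt·dxt·E/Mt = 4 + 2u` once the definitions are unfolded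
  have key' : xb u * dxb u * CoeffList.eval u cE / Mb u + xt u * dxt u * CoeffList.eval u cE / Mt u = 4 + 2 * u := by
    simpa [xb, xt, dxb, dxt, Mb, Mt] using key
  unfold gb gt
  rw [show xb u * dxb u * CoeffList.eval u cE / (Mb u * Real.sqrt (fC u)) =
      (xb u * dxb u * CoeffList.eval u cE / Mb u) / Real.sqrt (fC u) by rw [div_div],
    show xt u * dxt u * CoeffList.eval u cE / (Mt u * Real.sqrt (fC u)) =
      (xt u * dxt u * CoeffList.eval u cE / Mt u) / Real.sqrt (fC u) by rw [div_div],
    ← add_div, key']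

/-- **The integrand identity of the rule-(1b) step for `JLPairIdentityOne`**: on `u < −1`,
`x_b' E/(M_b √f_C) + x_t' E/(M_t √f_C) = (−10 − 6u)/√f_C(u)` (from `trace_row1` with `s = √disc`).
[evidence: stmt-KontsevichZagierPeriods-14654] -/
theorem trace_one {u : ℝ} (hu : u < -1) :
    dxb u * CoeffList.eval u cE / (Mb u * Real.sqrt (fC u)) + dxt u * CoeffList.eval u cE / (Mt u * Real.sqrt (fC u)) =
      (-10 - 6 * u) / Real.sqrt (fC u) := by
  have hQ := (Q_pos hu.le).ne'
  have hs0 := (sD_pos hu.le).ne'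
  have hs := sD_sq hu.le
  have hM := Mb_pos_and_Mt_pos hu.le
  have key := trace_row1 u (sD u) hs hs0 hQ (by simpa [Mb, xb] using hM.1.ne') (by simpa [Mt, xt] using hM.2.ne')
  have key' : dxb u * CoeffList.eval u cE / Mb u + dxt u * CoeffList.eval u cE / Mt u = -10 - 6 * u := by
    simpa [xb, xt, dxb, dxt, Mb, Mt] using key
  rw [show dxb u * CoeffList.eval u cE / (Mb u * Real.sqrt (fC u)) =
      (dxb u * CoeffList.eval u cE / Mb u) / Real.sqrt (fC u) by rw [div_div],
    show dxt u * CoeffList.eval u cE / (Mt u * Real.sqrt (fC u)) =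
      (dxt u * CoeffList.eval u cE / Mt u) / Real.sqrt (fC u) by rw [div_div],
    ← add_div, key']

end Pointwise

end Summit.KontsevichZagierPeriods.IsogenyCertificates.JLPair
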